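import Mathlib
import Literature.MathematicalPhysics.QuantumFieldTheory.Balaban1983to89.B14BoxFixWall

/-!
# `Balaban1983to89.B13Factor210` — the component factorization (2.10) of T. Bałaban, *Renormalization group
approach to lattice gauge field theories. II. Cluster expansions*, Commun. Math. Phys. **116**, 1–22 (1988),
doi:10.1007/bf01239022 [Balaban1988RG2Cluster] (cell paper B13 = [II]; PDF held
`paper:balaban1988-cmp116-rg-ii-cluster`, journal page = PDF page), p. 14: its COMBINATORIAL SKELETON
kernel-checked, with the unprinted geometric input (a) of cell `GAPS.md` G-adv4-23 PROVED and the analytic inputs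
(b), (c) of that row consumed ONLY as hypotheses (cell `GAPS.md` C-B13-18; unit `b2b-balaban-b13-g7`).

CITATION HEADER (lean-in-tree rule 2026-08-18).  The passage certified, [II] p. 14 [PDF 14], read by the typist on
the x2 render `b2b-balaban-ref1/pages/1988-cmp116-rg-II-cluster/1988-cmp116-rg-II-cluster-p014-x2.png`, verbatim:
*"The sums are over Z such, that each connected component of Z contains a component of Z′₀. The equalities (2.4),
(2.6), (2.8) imply (2.1) = Σ_Z H(Z), where*  `H(Z) = Σ_{Z₀: Z̃₀⊂Z} H(Z, Z₀).`  (2.9)  *"… From the definition of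
H(Z) it is also clear, that if Z = Z₁ ∪ … ∪ Z_n, where Z_i is a connected component of Z, then*
`H(Z) = H(Z₁) … H(Z_n).`  (2.10)  *"Thus finally we obtain the polymer expansion"* [display (2.11):
(2.1) = Σ_{{Z₁,…,Z_n}} H(Z₁)…H(Z_n) = 1 + Σ_{n≥1} (1/n!) Σ_{(Z₁,…,Z_n)} Π_{{i,j}, i<j} ζ(Z_i, Z_j) H(Z₁)…H(Z_n)]
*"where the function ζ(Z, Z′) is defined by the condition: ζ(Z, Z′) = 0 if Z ∩ Z′ contains a cube, or a wall of a
cube, and ζ(Z, Z′) = 1 otherwise."* (v1.1: the words between (2.10) and (2.11) re-read on the render p014-x2 — the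
print has exactly the seven words *"Thus finally we obtain the polymer expansion"* there; v1 had put a paraphrase in
quotation marks at this place, cell `GAPS.md` G-ref6-5.)  Context, p. 13 [PDF 13] (render `…-p013-x2.png`):
*"we take cubes from π_{k+1}, i.e. cubes of the size LM in the scale corresponding to the lattice T_η. We define σ₀
as the family of such cubes Δ disjoint with the interior of Z̃₀, or with the interior of Z′₀, where Z′₀ is a union
of the smallest family of such cubes containing Z̃₀."*  The notion of a connected family of
cubes is the one of [I] = T. Bałaban, Commun. Math. Phys. **109**, 249–301 (1987) [Balaban1987RG1], p. 257 [PDF 9]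
(render `b2b-balaban-ref1/pages/1987-cmp109-rg-I-small-field/1987-cmp109-rg-I-small-field-p009-x2.png`, re-read as
an image for v1.2), verbatim: *"We introduce a notion of a localization domain. Such a domain is a union of a
connected, finite family of cubes from π_j. A connected family means that for every pair □, □′ of cubes from the
family there exists a sequence □, □₁, …, □ₙ, □′ of cubes belonging to the family and such that two consecutive
cubes have a common wall, i.e. their intersection is a d − 1-dimensional cube."* (v1.2: v1 and v1.1 carried at this
place a re-worded version of this definition INSIDE quotation marks — not the printed wording; withdrawn, cell
`GAPS.md` C-B13-20) — typed in the tree module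
`…Balaban1983to89.B14Components` (`WallAdjacent`, `WStep`, `WConn`, `wComp`; the folklore closure lemmas
`mem_wComp_self`, `wComp_subset`, `WConn.mono` of `…Balaban1983to89.B14BoxFixWall`), which this module imports and
does not duplicate.

THE LOCATED GAP (cell `GAPS.md` G-adv4-23, adversarial reader `b2b-balaban-adv4-g20`, class unjustified-step, LOW):
*"(2.10) «H(Z) = H(Z₁)…H(Z_n)» is «clear from the definition of H(Z)» and is the load-bearing step of the polymer
expansion (2.11) … What it needs: (a) Z₀ in (2.4)/(2.9) ranges over finite unions of π_k-cubes … and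
Z₀ ↦ (Z₀∩Z_i)_i must be a bijection onto tuples with Z̃₀^{(i)} ⊂ Z_i; this holds because Z̃₀^{(i)} … is
wall-connected and Z₁,…,Z_n are wall-disjoint (a wall-connected set inside a wall-disjoint union lies in one piece)
— unprinted; (b) s-LOCALITY … (c) BLOCK-DIAGONALITY … ⇒ multiplicativity H(Z, Z₀) = Π_i H(Z_i, Z₀ ∩ Z_i)."*

WHAT IS REPRODUCED.  Cubes of `π_{k+1}` are modelled by their lattice indices `Pt d = Fin d → ℤ` (the carrier of
`…B14Components`); a localization domain `Z` is a finite family of cubes `Finset (Pt d)`; "connected component" =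
wall-component `wComp` of [I] p. 257; `ζ(Z, Z′) = 1` ("Z ∩ Z′ contains no cube and no wall of a cube") =
`WallSeparated ↑Z ↑Z′` (no common cube, no wall-adjacent pair).  Part A proves the geometric input (a) in the three
shapes it is used: `WallConnected.subset_member` / `WallConnected.subset_piece` (*a wall-connected family inside a
union of pairwise ζ-compatible pieces lies in one piece*), `wComp_union_left/right` (the wall-components of a
ζ-compatible union `Z₁ ∪ Z₂` are the wall-components of the pieces), `wComp_wallSeparated` + `sUnion_comps` (the
wall-components of any family are pairwise ζ-compatible and exhaust it — so (2.10)'s hypothesis "Z_i is a connected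
component of Z" is an instance of "pairwise ζ-compatible pieces"), and `comp_contains_comp_iff` (for `Z′ ⊆ Z`, a
component of `Z` *contains a component of* `Z′` iff it *meets* `Z′` — the form in which the range condition of
(2.8)/(2.9) is local).  Part B is the finite combinatorics of (2.9) ⇒ (2.10): with `Hsum adm act Z :=
Σ_{Z₀ ⊆ Z, adm Z Z₀} act Z Z₀` (the shape of (2.9): a sum over the admissible sub-families `Z₀` of `Z` of localized
activities `H(Z, Z₀)`), IF the admissibility predicate is local over ζ-compatible pieces (`AdmLocal`, the shape of
inputs (a)+(b)) and the activity is multiplicative over ζ-compatible pieces on admissible arguments (`ActMul`, the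
shape of input (c)), THEN `Hsum (Z₁ ∪ Z₂) = Hsum Z₁ * Hsum Z₂` for ζ-compatible `Z₁, Z₂` (`Hsum_union`, through the
powerset-of-a-disjoint-union bijection `sum_powerset_union`, [folklore]) and `Hsum (⋃_{i∈I} Z_i) = Π_{i∈I} Hsum Z_i`
for a finite pairwise ζ-compatible family (`Hsum_biUnion`) — (2.10) as printed, for the component decomposition or
any coarser ζ-compatible one.  Part C instantiates `AdmLocal` for the MODEL admissibility predicate `admMeets Z Z₀ :=
"every wall-component of Z meets Z₀"` (the printed range condition *"each connected component of Z contains a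
component of Z′₀"* in the form of `comp_contains_comp_iff`, with `Z′₀` replaced by the marked sub-family itself):
`admLocal_admMeets` — this is exactly where input (a) is consumed.

NOT ASSERTED.  Nothing printed in [II] is asserted: the module proves `(a)` outright and `AdmLocal ∧ ActMul ⇒ (2.10)`
and nothing else; whether the paper's `H(Z, Z₀)` (an integral over the fluctuation field with s-interpolated
propagators, (2.4)–(2.8)) satisfies `ActMul` (input (c): block-diagonality of `Δ_k(s), C^{(k)}(s)` over ζ-separated
components, [13] = B9 Sect. C) and whether the true admissibility condition («Z̃₀ ⊂ Z», Z̃₀ = Z₀ with M-cubes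
adjoined, plus the component condition on Z′₀) satisfies `AdmLocal` (inputs (a)+(b)) is NOT decided here — (c) and
(b) remain the by-reference inputs recorded in G-adv4-23; only their SHAPE is fixed by this file.  FAIRNESS OF THE
MODEL PREDICATE (v1.1, XREAD advisory A1 of cell `GAPS.md` C-ref6-69): `admMeets Z Z₀` reads the printed range
condition through `comp_contains_comp_iff`, which needs the marked family to lie INSIDE `Z`; the model keeps this as
the conjunct `Z₀ ⊆ Z` and drops the enlargements `Z̃₀ ⊆ Z′₀`.  In print the inclusion `Z′₀ ⊂ Z` holds by
construction and is not a separate hypothesis: (2.8) (p. 14, render p014-x2) displays the sum `Σ_Z` of the products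
`Π_{Δ⊂Z∖Z̃′₀} ∫₀¹ ds(Δ) ∂/∂s(Δ)` — so printed, with a tilde AND a prime on `Z₀` (×4 crop of the render re-read for
v1.2; v1.1 wrote `Z′₀` here without marking the printed diacritic); the symbol `Z̃′₀` is not defined in [II] and is
read as `Z′₀`, the only reading under which the cubes `Δ` belong to `σ₀` (cell `GAPS.md` G-adv4-24 (a),
`DIVERGENCE.md` D-adv5.3 — a recorded print slip, no mathematical content) — i.e. the domains `Z` of (2.8)–(2.9) are
`Z′₀` with cubes of `σ₀` adjoined, so
`Z ⊇ Z′₀ ⊇ Z̃₀ ⊇ Z₀`, and for a union `Z` of `π_{k+1}`-cubes the condition «Z̃₀ ⊂ Z» of (2.9) is the same as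
`Z′₀ ⊂ Z` (`Z′₀` = the smallest such union containing `Z̃₀`, p. 13).  Whether the LITERAL predicate (with the
enlargements, in a two-scale model of `π_k`-cubes inside `π_{k+1}`-cubes) is local over ζ-compatible pieces is not
decided in this file (cell `GAPS.md` C-B13-18 (4)).  The manuscript is under adjudication by the audit cell
`pub-balaban`; programme-internal claims are not cited.  Companion records: the
exact numerical second engine of (2.9)–(2.13) `b2b-balaban-adv4/g20/engine_b13_polymer.py` (cell `GAPS.md`
C-adv4-48), the schematic carrier `B13.ClusterData` of `…Balaban1983to89.B13` ((2.11)–(2.13) not modelled there,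
`DIVERGENCE.md` D-b13.1).  Staged byte-identically in the cell package
`run/shared/lean/pub/pub-balaban/lean/BalabanYm4/Literature/…/B13Factor210.lean`.

v1.1 (b2b-balaban-b13-g8, 2026-08-18, DOCFIX after XREAD ref6-g12 E69 / cell `GAPS.md` G-ref6-5 + advisory A1):
docstring-only — (i) in the CITATION HEADER the passage between (2.10) and (2.11) now quotes the print («Thus finally
we obtain the polymer expansion», render p014-x2 re-read as an image; v1 had a non-printed paraphrase about dividing
by the **J** = 0 expansion inside quotation marks there — withdrawn; the display (2.11) is given in brackets, not as a
quotation); (ii) the paragraph FAIRNESS OF THE MODEL PREDICATE and one sentence in the docstring of `admMeets` record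
that the model's reading of the range condition needs `Z′₀ ⊆ Z`, which (2.8) supplies by construction.  No
statement, proof or declaration name changed.

v1.2 (b2b-balaban-b13-g8, 2026-08-18, self-audit DOCFIX, cell `GAPS.md` C-B13-20): docstring-only — (i) the
CITATION HEADER's quotation of the [I] p. 257 definition of a connected family of cubes is now the printed wording
(render `…1987-cmp109-rg-I-small-field-p009-x2.png` re-read as an image); v1/v1.1 had a re-worded version inside
quotation marks there — withdrawn (same class of defect as G-ref6-5; not caught by the E69 cross-read, which checked
the [II] renders); (ii) the description of display (2.8) in FAIRNESS OF THE MODEL PREDICATE now reproduces the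
printed index `Δ ⊂ Z∖Z̃′₀` with its diacritics and names the cell's recorded reading `Z̃′₀ = Z′₀` (G-adv4-24 (a),
D-adv5.3).  No statement, proof or declaration name changed.
-/

namespace Literature.MathematicalPhysics.QuantumFieldTheory.Balaban1983to89.B13Factor210

open Literature.MathematicalPhysics.QuantumFieldTheory.Balaban1983to89.B14DomainGeom
open Literature.MathematicalPhysics.QuantumFieldTheory.Balaban1983to89.B14Components
open Literature.MathematicalPhysics.QuantumFieldTheory.Balaban1983to89.B14BoxFixWall

variable {d : ℕ}

/-! ## Part A. ζ-compatibility, wall-connected families, and input (a) of G-adv4-23 -/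

/-- `ζ(A, B) = 1` of [II] (2.11) p. 14 — *"ζ(Z, Z′) = 0 if Z ∩ Z′ contains a cube, or a wall of a cube, and
ζ(Z, Z′) = 1 otherwise"* — for families of cubes given by their indices: no common cube and no pair of cubes sharing
a `(d − 1)`-dimensional wall. [cite: Balaban1988RG2Cluster, p.14, (2.11)] -/
def WallSeparated (A B : Set (Pt d)) : Prop := ∀ a ∈ A, ∀ b ∈ B, a ≠ b ∧ ¬ WallAdjacent a b

namespace WallSeparated

/-- [folklore] -/
theorem symm {A B : Set (Pt d)} (h : WallSeparated A B) : WallSeparated B A :=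
  fun b hb a ha => ⟨(h a ha b hb).1.symm, fun hw => (h a ha b hb).2 hw.symm⟩

/-- [folklore] -/
theorem mono {A A' B B' : Set (Pt d)} (h : WallSeparated A B) (hA : A' ⊆ A) (hB : B' ⊆ B) :
    WallSeparated A' B' :=
  fun a ha b hb => h a (hA ha) b (hB hb)

/-- ζ-compatible families are disjoint. [folklore] -/
theorem disjoint {A B : Set (Pt d)} (h : WallSeparated A B) : Disjoint A B :=
  Set.disjoint_left.mpr fun a ha hb => (h a ha a hb).1 rfl

/-- [folklore] -/
theorem empty_left (B : Set (Pt d)) : WallSeparated (∅ : Set (Pt d)) B := fun a ha => by simp at ha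

/-- [folklore] -/
theorem union_left {A A' B : Set (Pt d)} (h : WallSeparated A B) (h' : WallSeparated A' B) :
    WallSeparated (A ∪ A') B :=
  fun a ha b hb => ha.elim (fun ha => h a ha b hb) (fun ha => h' a ha b hb)

/-- A (doubly indexed) union of families each ζ-compatible with `B` is ζ-compatible with `B`. [folklore] -/
theorem iUnion₂_left {ι : Sort*} {p : ι → Prop} {A : ι → Set (Pt d)} {B : Set (Pt d)}
    (h : ∀ i, p i → WallSeparated (A i) B) : WallSeparated (⋃ i, ⋃ (_ : p i), A i) B := by
  intro a ha b hb
  obtain ⟨i, hi, hai⟩ := Set.mem_iUnion₂.mp ha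
  exact h i hi a hai b hb

/-- Finite-set form. [folklore] -/
theorem of_finset {A B : Finset (Pt d)} (h : WallSeparated (↑A : Set (Pt d)) ↑B) : Disjoint A B :=
  Finset.disjoint_coe.mp h.disjoint

end WallSeparated

/-- A WALL-CONNECTED family of cubes, [I] p. 257: any two of its cubes are joined by a chain of its cubes, consecutive
ones sharing a `(d − 1)`-dimensional wall (`WConn S` of `…B14Components`). [cite: Balaban1987RG1, p.257] -/
def WallConnected (S : Set (Pt d)) : Prop := ∀ x ∈ S, ∀ y ∈ S, WConn S x y

/-- [folklore] -/
theorem wComp_mono {R R' : Set (Pt d)} (h : R ⊆ R') (a : Pt d) : wComp R a ⊆ wComp R' a :=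
  fun _ hb => WConn.mono h hb

/-- A chain inside `R` from `a` stays inside the wall-component of `a`. [folklore] -/
theorem wconn_within_wComp {R : Set (Pt d)} {a b : Pt d} (h : WConn R a b) : WConn (wComp R a) a b := by
  induction h with
  | refl => exact Relation.ReflTransGen.refl
  | tail hab hstep ih =>
    exact Relation.ReflTransGen.tail ih ⟨hab, Relation.ReflTransGen.tail hab hstep, hstep.2.2⟩

/-- Wall-components are wall-connected families. [folklore] -/
theorem wallConnected_wComp (R : Set (Pt d)) (a : Pt d) : WallConnected (wComp R a) := by
  intro x hx y hy
  exact Relation.ReflTransGen.trans (WConn.symm (wconn_within_wComp hx)) (wconn_within_wComp hy)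

/-- Two cubes in one wall-component have the same wall-component. [folklore] -/
theorem wComp_eq_of_mem {R : Set (Pt d)} {a b : Pt d} (hb : b ∈ wComp R a) : wComp R b = wComp R a := by
  ext c
  constructor
  · intro hc; exact Relation.ReflTransGen.trans hb hc
  · intro hc; exact Relation.ReflTransGen.trans (WConn.symm hb) hc

/-- A wall-connected family inside `R` lies inside ONE wall-component of `R`. [folklore] -/
theorem WallConnected.subset_wComp {S R : Set (Pt d)} (hS : WallConnected S) (hSR : S ⊆ R) {a : Pt d}
    (ha : a ∈ S) : S ⊆ wComp R a :=
  fun y hy => WConn.mono hSR (hS a ha y hy)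

/-- INPUT (a) OF G-adv4-23, family form: *a wall-connected set inside a wall-disjoint union lies in one piece* — if a
wall-connected family `S` is covered by a collection `𝒵` of pairwise ζ-compatible families, then `S` lies inside the
member of `𝒵` containing any one of its cubes. [folklore] (cell GAPS.md G-adv4-23 (a)) -/
theorem WallConnected.subset_member {𝒵 : Set (Set (Pt d))} {S : Set (Pt d)} (hS : WallConnected S)
    (hsub : S ⊆ ⋃₀ 𝒵) (hsep : 𝒵.Pairwise WallSeparated) {a : Pt d} (ha : a ∈ S) {K : Set (Pt d)} (hK : K ∈ 𝒵)
    (haK : a ∈ K) : S ⊆ K := by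
  suffices h : ∀ z, WConn S a z → z ∈ K from fun y hy => h y (hS a ha y hy)
  intro z hz
  induction hz with
  | refl => exact haK
  | tail _ hstep ih =>
    obtain ⟨_, hcS, hadj⟩ := hstep
    obtain ⟨K', hK', hcK'⟩ := Set.mem_sUnion.mp (hsub hcS)
    by_contra hcK
    have hne : K ≠ K' := by rintro rfl; exact hcK hcK'
    exact (hsep hK hK' hne _ ih _ hcK').2 hadj

/-- INPUT (a) OF G-adv4-23, indexed form: pieces `Z i`, `i ∈ I`, pairwise ζ-compatible; a wall-connected family
inside `⋃_{i∈I} Z i` lies inside the piece containing any one of its cubes. [folklore] (cell GAPS.md G-adv4-23 (a)) -/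
theorem WallConnected.subset_piece {ι : Type*} {I : Finset ι} {Z : ι → Set (Pt d)} {S : Set (Pt d)}
    (hS : WallConnected S) (hsub : S ⊆ ⋃ i ∈ I, Z i)
    (hsep : (↑I : Set ι).Pairwise fun i j => WallSeparated (Z i) (Z j))
    {a : Pt d} (ha : a ∈ S) {i : ι} (hi : i ∈ I) (hai : a ∈ Z i) : S ⊆ Z i := by
  suffices h : ∀ z, WConn S a z → z ∈ Z i from fun y hy => h y (hS a ha y hy)
  intro z hz
  induction hz with
  | refl => exact hai
  | tail _ hstep ih =>
    obtain ⟨_, hcS, hadj⟩ := hstep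
    obtain ⟨j, hj, hcj⟩ := Set.mem_iUnion₂.mp (hsub hcS)
    by_contra hci
    have hne : i ≠ j := by rintro rfl; exact hci hcj
    exact (hsep (Finset.mem_coe.mpr hi) (Finset.mem_coe.mpr hj) hne _ ih _ hcj).2 hadj

/-- Existence form of input (a): a nonempty wall-connected family inside a pairwise ζ-compatible finite union lies in
some piece (the one through any of its cubes, `subset_piece`). [folklore] (cell GAPS.md G-adv4-23 (a)) -/
theorem WallConnected.exists_subset_piece {ι : Type*} {I : Finset ι} {Z : ι → Set (Pt d)} {S : Set (Pt d)}
    (hS : WallConnected S) (hsub : S ⊆ ⋃ i ∈ I, Z i)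
    (hsep : (↑I : Set ι).Pairwise fun i j => WallSeparated (Z i) (Z j)) (hne : S.Nonempty) :
    ∃ i ∈ I, S ⊆ Z i := by
  obtain ⟨a, ha⟩ := hne
  obtain ⟨i, hi, hai⟩ := Set.mem_iUnion₂.mp (hsub ha)
  exact ⟨i, hi, hS.subset_piece hsub hsep ha hi hai⟩

/-- The wall-components of a ζ-compatible union `Z₁ ∪ Z₂` through cubes of `Z₁` are the wall-components of `Z₁`.
[folklore] (cell GAPS.md G-adv4-23 (a)) -/
theorem wComp_union_left {Z₁ Z₂ : Set (Pt d)} (hsep : WallSeparated Z₁ Z₂) {a : Pt d} (ha : a ∈ Z₁) :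
    wComp (Z₁ ∪ Z₂) a = wComp Z₁ a := by
  apply Set.Subset.antisymm
  · have hsub : wComp (Z₁ ∪ Z₂) a ⊆ Z₁ := by
      intro c hc
      induction hc with
      | refl => exact ha
      | tail _ hstep ih =>
        rcases hstep.2.1 with hc₁ | hc₂
        · exact hc₁
        · exact absurd hstep.2.2 (hsep _ ih _ hc₂).2
    intro c hc
    exact WConn.mono hsub (wconn_within_wComp hc)
  · exact wComp_mono Set.subset_union_left a

/-- Same for cubes of `Z₂`. [folklore] -/
theorem wComp_union_right {Z₁ Z₂ : Set (Pt d)} (hsep : WallSeparated Z₁ Z₂) {a : Pt d} (ha : a ∈ Z₂) :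
    wComp (Z₁ ∪ Z₂) a = wComp Z₂ a := by
  rw [Set.union_comm]; exact wComp_union_left hsep.symm ha

/-- Distinct wall-components of a family are ζ-compatible: no common cube, no shared wall (else they would be one
component).  So "Z_i is a connected component of Z" in (2.10) is an instance of "pairwise ζ-compatible pieces".
[folklore] (the decomposition of [II] p.14 (2.10)) -/
theorem wComp_wallSeparated {R : Set (Pt d)} {a b : Pt d} (ha : a ∈ R) (hb : b ∈ R)
    (hne : wComp R a ≠ wComp R b) : WallSeparated (wComp R a) (wComp R b) := by
  intro x hx y hy
  refine ⟨?_, ?_⟩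
  · rintro rfl
    exact hne ((wComp_eq_of_mem hx).symm.trans (wComp_eq_of_mem hy))
  · intro hadj
    have hy' : y ∈ wComp R a :=
      Relation.ReflTransGen.tail hx ⟨wComp_subset ha hx, wComp_subset hb hy, hadj⟩
    exact hne ((wComp_eq_of_mem hy').symm.trans (wComp_eq_of_mem hy))

/-- The set of wall-components of a family `R`. [cite: Balaban1987RG1, p.257] -/
def comps (R : Set (Pt d)) : Set (Set (Pt d)) := (fun a => wComp R a) '' R

/-- The wall-components are pairwise ζ-compatible. [folklore] -/
theorem comps_pairwise_wallSeparated (R : Set (Pt d)) : (comps R).Pairwise WallSeparated := by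
  rintro K ⟨a, ha, rfl⟩ K' ⟨b, hb, rfl⟩ hne
  exact wComp_wallSeparated ha hb hne

/-- … and they exhaust the family: `Z = Z₁ ∪ … ∪ Z_n`. [folklore] -/
theorem sUnion_comps (R : Set (Pt d)) : ⋃₀ comps R = R := by
  rw [comps, Set.sUnion_image]
  ext x
  rw [Set.mem_iUnion₂]
  constructor
  · rintro ⟨a, ha, hx⟩; exact wComp_subset ha hx
  · intro hx; exact ⟨x, hx, mem_wComp_self R x⟩

/-- Every wall-connected sub-family of `R` lies in one of its wall-components (input (a) applied to the component
decomposition). [folklore] (cell GAPS.md G-adv4-23 (a)) -/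
theorem WallConnected.subset_comp {S R : Set (Pt d)} (hS : WallConnected S) (hSR : S ⊆ R) (hne : S.Nonempty) :
    ∃ K ∈ comps R, S ⊆ K := by
  obtain ⟨a, ha⟩ := hne
  exact ⟨wComp R a, ⟨a, hSR ha, rfl⟩, hS.subset_wComp hSR ha⟩

/-- The range condition of (2.8)/(2.9) in local form: for a sub-family `Z′ ⊆ Z`, a wall-component of `Z` *contains a
(wall-)component of `Z′`* iff it *meets* `Z′` (a component of `Z′` through a common cube is wall-connected inside
`Z`, hence inside that component of `Z` — input (a)). [folklore] (the range condition of [II] p.14 l.1) -/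
theorem comp_contains_comp_iff {Z Z' : Set (Pt d)} (hZ' : Z' ⊆ Z) (a : Pt d) :
    (∃ b ∈ Z', wComp Z' b ⊆ wComp Z a) ↔ (wComp Z a ∩ Z').Nonempty := by
  constructor
  · rintro ⟨b, hb, hsub⟩; exact ⟨b, hsub (mem_wComp_self Z' b), hb⟩
  · rintro ⟨b, hba, hb⟩
    refine ⟨b, hb, ?_⟩
    rw [← wComp_eq_of_mem hba]
    exact wComp_mono hZ' b

/-! ## Part B. The finite combinatorics of (2.9) ⇒ (2.10) -/

section PowersetOfDisjointUnion

variable {α : Type*} [DecidableEq α] {β : Type*} [AddCommMonoid β]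

/-- The sub-families of a disjoint union `s ∪ t` are the unions `W₁ ∪ W₂` of a sub-family of `s` and one of `t`,
bijectively (`Z₀ ↦ (Z₀ ∩ Z₁, Z₀ ∩ Z₂)` of G-adv4-23 (a)): the sum form. [folklore] -/
theorem sum_powerset_union {s t : Finset α} (hst : Disjoint s t) (f : Finset α → β) :
    ∑ W ∈ (s ∪ t).powerset, f W = ∑ p ∈ s.powerset ×ˢ t.powerset, f (p.1 ∪ p.2) := by
  have hsplit : ∀ W : Finset α, W ⊆ s ∪ t → W ∩ s ∪ W ∩ t = W := fun W hW => by
    ext x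
    simp only [Finset.mem_union, Finset.mem_inter]
    constructor
    · rintro (⟨hx, _⟩ | ⟨hx, _⟩) <;> exact hx
    · intro hx
      rcases Finset.mem_union.mp (hW hx) with h | h
      · exact Or.inl ⟨hx, h⟩
      · exact Or.inr ⟨hx, h⟩
  refine Finset.sum_nbij' (fun W => (W ∩ s, W ∩ t)) (fun p => p.1 ∪ p.2) ?_ ?_ ?_ ?_ ?_
  · intro W _
    simp only [Finset.mem_product, Finset.mem_powerset]
    exact ⟨Finset.inter_subset_right, Finset.inter_subset_right⟩
  · intro p hp
    rw [Finset.mem_product, Finset.mem_powerset, Finset.mem_powerset] at hp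
    rw [Finset.mem_powerset]
    exact Finset.union_subset_union hp.1 hp.2
  · intro W hW
    rw [Finset.mem_powerset] at hW
    exact hsplit W hW
  · intro p hp
    rw [Finset.mem_product, Finset.mem_powerset, Finset.mem_powerset] at hp
    obtain ⟨h₁, h₂⟩ := hp
    have e₁ : (p.1 ∪ p.2) ∩ s = p.1 := by
      ext x
      simp only [Finset.mem_inter, Finset.mem_union]
      constructor
      · rintro ⟨hx | hx, hs⟩
        · exact hx
        · exact absurd hs (Finset.disjoint_right.mp hst (h₂ hx))
      · intro hx; exact ⟨Or.inl hx, h₁ hx⟩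
    have e₂ : (p.1 ∪ p.2) ∩ t = p.2 := by
      ext x
      simp only [Finset.mem_inter, Finset.mem_union]
      constructor
      · rintro ⟨hx | hx, ht⟩
        · exact absurd ht (Finset.disjoint_left.mp hst (h₁ hx))
        · exact hx
      · intro hx; exact ⟨Or.inr hx, h₂ hx⟩
    exact Prod.ext e₁ e₂
  · intro W hW
    rw [Finset.mem_powerset] at hW
    simp only [hsplit W hW]

end PowersetOfDisjointUnion

section Activities

variable {R : Type*} [CommSemiring R]

/-- The shape of (2.9): `H(Z) = Σ_{Z₀: Z̃₀⊂Z} H(Z, Z₀)` — a finite sum, over the ADMISSIBLE sub-families `Z₀ ⊆ Z`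
(`adm Z Z₀`: «Z̃₀ ⊂ Z» and «each connected component of Z contains a component of Z′₀»), of the localized
activities `H(Z, Z₀)` (`act Z Z₀`). [cite: Balaban1988RG2Cluster, p.14, (2.9)] -/
def Hsum (adm : Finset (Pt d) → Finset (Pt d) → Prop) [∀ Z Z₀, Decidable (adm Z Z₀)]
    (act : Finset (Pt d) → Finset (Pt d) → R) (Z : Finset (Pt d)) : R :=
  ∑ Z₀ ∈ Z.powerset with adm Z Z₀, act Z Z₀

/-- LOCALITY of admissibility over ζ-compatible pieces — the SHAPE of inputs (a) + (b) of G-adv4-23: for ζ-compatible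
`Z₁, Z₂` and `Wᵢ ⊆ Zᵢ`, `W₁ ∪ W₂` is admissible for `Z₁ ∪ Z₂` iff each `Wᵢ` is admissible for `Zᵢ`.  A HYPOTHESIS
shape, instantiated for the model predicate `admMeets` in Part C; NOT asserted for the paper's condition; a
DEFINITION of a property of the abstract pair `(adm, act)`, not a named fact (the printed source of the shape is
[II] p.14 (2.9)–(2.10), cell GAPS.md G-adv4-23 (a),(b)). [folklore] -/
def AdmLocal (adm : Finset (Pt d) → Finset (Pt d) → Prop) : Prop :=
  ∀ Z₁ Z₂ W₁ W₂ : Finset (Pt d), WallSeparated (↑Z₁ : Set (Pt d)) ↑Z₂ → W₁ ⊆ Z₁ → W₂ ⊆ Z₂ →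
    (adm (Z₁ ∪ Z₂) (W₁ ∪ W₂) ↔ adm Z₁ W₁ ∧ adm Z₂ W₂)

/-- MULTIPLICATIVITY of the localized activity over ζ-compatible pieces on admissible arguments — the SHAPE of input
(c) of G-adv4-23 (*"BLOCK-DIAGONALITY: Δ_k(s), C^{(k)}(s) do not couple wall-separated components ⇒ multiplicativity
H(Z, Z₀) = Π_i H(Z_i, Z₀ ∩ Z_i)"*).  A HYPOTHESIS shape; NOT asserted for the paper's `H(Z, Z₀)`; a DEFINITION of
a property of the abstract pair `(adm, act)`, not a named fact (printed source of the shape: [II] p.14 (2.10), cell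
GAPS.md G-adv4-23 (c)). [folklore] -/
def ActMul (adm : Finset (Pt d) → Finset (Pt d) → Prop) (act : Finset (Pt d) → Finset (Pt d) → R) : Prop :=
  ∀ Z₁ Z₂ W₁ W₂ : Finset (Pt d), WallSeparated (↑Z₁ : Set (Pt d)) ↑Z₂ → W₁ ⊆ Z₁ → W₂ ⊆ Z₂ →
    adm Z₁ W₁ → adm Z₂ W₂ → act (Z₁ ∪ Z₂) (W₁ ∪ W₂) = act Z₁ W₁ * act Z₂ W₂

variable {adm : Finset (Pt d) → Finset (Pt d) → Prop} [∀ Z Z₀, Decidable (adm Z Z₀)]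
variable {act : Finset (Pt d) → Finset (Pt d) → R}

/-- (2.10) FOR TWO ζ-COMPATIBLE PIECES: `H(Z₁ ∪ Z₂) = H(Z₁) H(Z₂)`, given locality of admissibility and
multiplicativity of the activity (the bijection `Z₀ ↦ (Z₀ ∩ Z₁, Z₀ ∩ Z₂)` of input (a) is `sum_powerset_union`).
[cite: Balaban1988RG2Cluster, p.14, (2.10)] -/
theorem Hsum_union (hadm : AdmLocal adm) (hact : ActMul adm act) {Z₁ Z₂ : Finset (Pt d)}
    (hsep : WallSeparated (↑Z₁ : Set (Pt d)) ↑Z₂) :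
    Hsum adm act (Z₁ ∪ Z₂) = Hsum adm act Z₁ * Hsum adm act Z₂ := by
  have hdisj : Disjoint Z₁ Z₂ := WallSeparated.of_finset hsep
  unfold Hsum
  rw [Finset.sum_filter, Finset.sum_filter, Finset.sum_filter, sum_powerset_union hdisj, Finset.sum_product,
    Finset.sum_mul_sum]
  refine Finset.sum_congr rfl fun W₁ hW₁ => Finset.sum_congr rfl fun W₂ hW₂ => ?_
  rw [Finset.mem_powerset] at hW₁ hW₂
  have hloc := hadm Z₁ Z₂ W₁ W₂ hsep hW₁ hW₂
  by_cases h₁ : adm Z₁ W₁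
  · by_cases h₂ : adm Z₂ W₂
    · rw [if_pos (hloc.mpr ⟨h₁, h₂⟩), if_pos h₁, if_pos h₂]
      exact hact Z₁ Z₂ W₁ W₂ hsep hW₁ hW₂ h₁ h₂
    · have h₁₂ : ¬ adm (Z₁ ∪ Z₂) (W₁ ∪ W₂) := fun h => h₂ (hloc.mp h).2
      rw [if_neg h₁₂, if_neg h₂, mul_zero]
  · have h₁₂ : ¬ adm (Z₁ ∪ Z₂) (W₁ ∪ W₂) := fun h => h₁ (hloc.mp h).1
    rw [if_neg h₁₂, if_neg h₁, zero_mul]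

/-- (2.10) AS PRINTED, `H(Z) = H(Z₁) … H(Z_n)` for `Z = Z₁ ∪ … ∪ Z_n` with the `Z_i` pairwise ζ-compatible (in
particular for the wall-component decomposition, `comps_pairwise_wallSeparated`), given locality of admissibility,
multiplicativity of the activity and the normalization `H(∅) = 1`. [cite: Balaban1988RG2Cluster, p.14, (2.10)] -/
theorem Hsum_biUnion {ι : Type*} [DecidableEq ι] (hadm : AdmLocal adm) (hact : ActMul adm act)
    (h0 : Hsum adm act ∅ = 1) (Z : ι → Finset (Pt d)) (I : Finset ι)
    (hsep : (↑I : Set ι).Pairwise fun i j => WallSeparated (↑(Z i) : Set (Pt d)) ↑(Z j)) :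
    Hsum adm act (I.biUnion Z) = ∏ i ∈ I, Hsum adm act (Z i) := by
  induction I using Finset.induction_on with
  | empty => simpa using h0
  | insert a I haI ih =>
    have hsep' : (↑I : Set ι).Pairwise fun i j => WallSeparated (↑(Z i) : Set (Pt d)) ↑(Z j) :=
      hsep.mono (Finset.coe_subset.mpr (Finset.subset_insert a I))
    have hsepU : WallSeparated (↑(Z a) : Set (Pt d)) ↑(I.biUnion Z) := by
      rw [Finset.coe_biUnion]
      refine (WallSeparated.iUnion₂_left fun i hi => ?_).symm
      have hi' : i ∈ I := Finset.mem_coe.mp hi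
      have hia : i ≠ a := by rintro rfl; exact haI hi'
      exact hsep (Finset.mem_coe.mpr (Finset.mem_insert_of_mem hi'))
        (Finset.mem_coe.mpr (Finset.mem_insert_self a I)) hia
    rw [Finset.biUnion_insert, Finset.prod_insert haI, Hsum_union hadm hact hsepU, ih hsep']

/-- The value at the empty domain: `H(∅) = H(∅, ∅)` if the empty sub-family is admissible, else `0`; so the
normalization `H(∅) = 1` of `Hsum_biUnion` reads `adm ∅ ∅ ∧ act ∅ ∅ = 1`. [folklore] -/
theorem Hsum_empty : Hsum adm act ∅ = if adm ∅ ∅ then act ∅ ∅ else 0 := by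
  unfold Hsum
  rw [Finset.sum_filter, Finset.powerset_empty, Finset.sum_singleton]

end Activities

/-! ## Part C. The model admissibility predicate: every component of `Z` is marked -/

section Model

/-- MODEL admissibility predicate: *every wall-component of `Z` meets the marked sub-family `Z₀`* — the printed
range condition *"each connected component of Z contains a component of Z′₀"* ((2.8)/(2.9), p. 14 l. 1) in the
local form of `comp_contains_comp_iff`, with the marked family standing in for `Z′₀`.  The reading is fair only
together with the conjunct `Z₀ ⊆ Z` (print: `Z′₀ ⊂ Z`, which the domains `Z` of (2.8) satisfy by construction — see
the module docstring, FAIRNESS OF THE MODEL PREDICATE, v1.1); the enlargements `Z₀ ⊆ Z̃₀ ⊆ Z′₀` are not modelled.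
[cite: Balaban1988RG2Cluster, p.14, (2.9)] -/
def admMeets (Z Z₀ : Finset (Pt d)) : Prop :=
  Z₀ ⊆ Z ∧ ∀ a ∈ Z, ∃ b ∈ Z₀, b ∈ wComp (↑Z : Set (Pt d)) a

/-- INPUT (a) CONSUMED: the model predicate is local over ζ-compatible pieces (`AdmLocal admMeets`), because the
wall-components of a ζ-compatible union are the wall-components of the pieces (`wComp_union_left/right`).
[folklore] (cell GAPS.md G-adv4-23 (a)) -/
theorem admLocal_admMeets [∀ Z Z₀ : Finset (Pt d), Decidable (admMeets Z Z₀)] :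
    AdmLocal (d := d) admMeets := by
  intro Z₁ Z₂ W₁ W₂ hsep hW₁ hW₂
  have hdisj : Disjoint Z₁ Z₂ := WallSeparated.of_finset hsep
  have hU : (↑(Z₁ ∪ Z₂) : Set (Pt d)) = ↑Z₁ ∪ ↑Z₂ := Finset.coe_union Z₁ Z₂
  constructor
  · rintro ⟨_, hall⟩
    refine ⟨⟨hW₁, fun a ha => ?_⟩, ⟨hW₂, fun a ha => ?_⟩⟩
    · obtain ⟨b, hb, hba⟩ := hall a (Finset.mem_union_left Z₂ ha)
      rw [hU, wComp_union_left hsep (Finset.mem_coe.mpr ha)] at hba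
      have hbZ₁ : b ∈ Z₁ := Finset.mem_coe.mp (wComp_subset (Finset.mem_coe.mpr ha) hba)
      rcases Finset.mem_union.mp hb with hb₁ | hb₂
      · exact ⟨b, hb₁, hba⟩
      · exact absurd (hW₂ hb₂) (Finset.disjoint_left.mp hdisj hbZ₁)
    · obtain ⟨b, hb, hba⟩ := hall a (Finset.mem_union_right Z₁ ha)
      rw [hU, wComp_union_right hsep (Finset.mem_coe.mpr ha)] at hba
      have hbZ₂ : b ∈ Z₂ := Finset.mem_coe.mp (wComp_subset (Finset.mem_coe.mpr ha) hba)
      rcases Finset.mem_union.mp hb with hb₁ | hb₂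
      · exact absurd hbZ₂ (Finset.disjoint_left.mp hdisj (hW₁ hb₁))
      · exact ⟨b, hb₂, hba⟩
  · rintro ⟨⟨_, h₁⟩, ⟨_, h₂⟩⟩
    refine ⟨Finset.union_subset_union hW₁ hW₂, fun a ha => ?_⟩
    rcases Finset.mem_union.mp ha with ha₁ | ha₂
    · obtain ⟨b, hb, hba⟩ := h₁ a ha₁
      refine ⟨b, Finset.mem_union_left W₂ hb, ?_⟩
      rw [hU, wComp_union_left hsep (Finset.mem_coe.mpr ha₁)]
      exact hba
    · obtain ⟨b, hb, hba⟩ := h₂ a ha₂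
      refine ⟨b, Finset.mem_union_right W₁ hb, ?_⟩
      rw [hU, wComp_union_right hsep (Finset.mem_coe.mpr ha₂)]
      exact hba

/-- Hence (2.10) for the model predicate and ANY activity multiplicative over ζ-compatible pieces on admissible
arguments: `H(Z₁ ∪ Z₂) = H(Z₁) H(Z₂)`. [cite: Balaban1988RG2Cluster, p.14, (2.10)] -/
theorem Hsum_union_admMeets [∀ Z Z₀ : Finset (Pt d), Decidable (admMeets Z Z₀)] {R : Type*} [CommSemiring R]
    {act : Finset (Pt d) → Finset (Pt d) → R} (hact : ActMul admMeets act) {Z₁ Z₂ : Finset (Pt d)}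
    (hsep : WallSeparated (↑Z₁ : Set (Pt d)) ↑Z₂) :
    Hsum admMeets act (Z₁ ∪ Z₂) = Hsum admMeets act Z₁ * Hsum admMeets act Z₂ :=
  Hsum_union admLocal_admMeets hact hsep

/-- A two-cube sanity instance (d = 1): the cubes `0` and `5` of `ℤ` are ζ-compatible (neither equal nor
wall-adjacent), so any wall-connected family inside `{0} ∪ {5}` containing `0` is `⊆ {0}`. [folklore] -/
example : WallSeparated (d := 1) {fun _ => 0} {fun _ => 5} := by
  intro a ha b hb
  rw [Set.mem_singleton_iff] at ha hb
  subst ha; subst hb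
  refine ⟨fun h => by simpa using congrFun h 0, fun ⟨i, hi, _⟩ => ?_⟩
  simp at hi

end Model

end Literature.MathematicalPhysics.QuantumFieldTheory.Balaban1983to89.B13Factor210
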